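import Literature.MathematicalPhysics.QuantumFieldTheory.Balaban1983to89.B8Eq1101CubeMemberReal
import Literature.MathematicalPhysics.QuantumFieldTheory.Balaban1983to89.B8Eq1101CubeMemberWeights

/-!
# `Balaban1983to89.B8Eq1101CubeMemberRealM4` — [Balaban1985RegularSpaces] (1.101) AT `U₀ = 1` ON THE CUBE MEMBER, EXPONENT `−4 → −2`
# ([Balaban1985BackgroundPropagators] (3.47) «|G′(U)λ|₍₂₊γ₎ ≦ B₀|λ|₍γ₎ … for γ in a fixed compact subset of real numbers, e.g. for γ ∈ [−4, 4]» at γ = −4):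
# the hypothesis REAL-1′ of `B8Eq192CubeMemberOfReal1G.real2_of_real1_gbound`, proved on print's big-block sub-lattice, weights discharged at `wPrinted`

statement-level skeleton of published theorems with citation tags; proofs where landed; nothing here is a claim about the
Yang–Mills mass gap

`[Balaban1985RegularSpaces]` ("B8", CMP **99** (1985) 75–102) (1.101) p. 93, p. 98, (1.131) p. 99; `[Balaban1985BackgroundPropagators]` ("[4]") Theorem 3.1 with (3.47)
p. 398; `[Balaban1984PropagatorsII]` ("[B6]") (2.47)–(2.58) pp. 231–233 (the two-region expansion «convergent for M sufficiently large»), Prop. 2.2 (2.67) p. 234.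

CITATION HEADER (lean-in-tree rule).  Cell `pub-ymgap` (YM Track A, HUMAN RULING D-0062), DAG node N05 = [B8], seat `pub-ymgap-dag-n05-c` (g9; (R1′) programme, file F7).
F6 (`B8Eq192CubeMemberOfReal1G`) reduced the consumer's REAL-2 family to REAL-1 (landed, F4c–F4e) + REAL-1′ ((1.101) at exponent `−4 → −2`, function member) + the
𝒢-bound.  THIS FILE proves REAL-1′ — the same two-region parametrix as F4b∕F4c, with three changes: region A is read from r05's GENERAL-EXPONENT
`B8Ineq198MultiLevelBox.ineq1101_multiLevelBox` (exponent 4; §1–§2); the commutator `K₁u` is shown to VANISH on `□₂` (§3: the site, its neighbours and its tower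
block are deeper than `4s` into `□₁`, where `h̃_A ≡ 1`, `h̃_B ≡ 0`), so that its `(−4)`-weighted size is read at levels `≤ 1` only, where F4b's `commutator_bound`
costs an extra `L²` (ramp threshold `s₀′ = 20(d+1)L⁴(C′ + C_W)`); the a-priori inversion (F4c §1) is applied to the WEIGHTED functional `u ↦ (Lʲη)²(T⁻¹u)(v)`.
After this file the p6 flat road's open real estimate is the 𝒢-bound ALONE ([4] Theorem 3.2 (3.48) for `𝒢 = (QT⁻²Qᵀ)⁻¹` of the glued operator).

WHAT THIS FILE PROVES (kernel-checked; theorems only).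
* §1 `ineq1101_regionA_pow` — r05's general-exponent (1.101) on p21's Neumann box read at the cube member `cubeDomains` (F1), by `exact`.
* §2 `regionA_bounds4` — `(Lʲη)⁴|u| ≤ N` on `□_j` ⟹ `η⁴(L^{lev y})²|(G′u_A)(y)| ≤ C′N` for the truncated translated source `u_A = h_A·u`.
* §3 `commutator_vanish_deep` — for `x ∈ □₂` (`4s + (d+1)ℓ ≤ ρL`) the commutator row `Σ_z K(x,z)((h̃_A(z) − h̃_A(x))η²g_A(z) + (h̃_B(z) − h̃_B(x))g_B(z))` is `0`.
* §4 ★★★ `ineq1101_cubeMember_m4` — same data regime and weight hypotheses as F4c∕F4d (`ρ₀` larger by the factor `L²` in `s₀′`): for every source `u` on `□₀` with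
  `wt(j)⁴|u| ≤ r` on `□_j` (`j ≤ n`): `wt(j)²|Σ_z T⁻¹(v,z)u(z)| ≤ B_G′·r` for `v ∈ □_j`, `B_G′ = 2(C′ + L²C_W)` — EXACTLY the shape of F6's hypothesis `hR1'`.
* §5 ★★★ `ineq1101_cubeMember_m4_printed` — §4 at `w = wPrinted d ℓ η`, `a = awPrinted ℓ` (no weight hypothesis left), as F4e.

HONEST SCOPE ∕ NOT CLAIMED.  Function member only (the gradient member at exponent 4 is not needed by F6).  Print's big-block sub-lattice of data (`M_hL ∣ ρ, M`,
thresholds `M₀, N₀, ρ₀`; non-empty by `B8Eq1101CubeMemberWeights.admissibleData_exists`), as for REAL-1.  The 𝒢-bound remains OPEN; N05 NOT discharged; count-neutral;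
one finite `T⁴` programme at fixed `ε`, Bałaban as printed; nothing continuum ∕ ℝ⁴ ∕ OS ∕ mass-gap ∕ Clay.  No `sorry`, no `def`, no `instance`, no `notation`;
`set_option maxHeartbeats 400000 in` on the §4 assembly (as F4d).  One topic (the exponent-4 run); 5 theorems.  Unit `pub-ymgap-dag-n05-c` (g9), 2026-08-27.

RELATED IN THE TREE, NOT DUPLICATED: `B8Eq1101CubeMemberReal.ineq1101_cubeMember_sup` ∕ `apriori_functional_bound` (F4c; exponent `−2 → 0`; the a-priori lemma USED),
`B8Eq1101CubeMemberParametrixIdentity.{parametrix_identity, regionB_bound, commutator_bound}` (F4b, USED), `B8CubeMemberBoxDomains.{cubeDomains, ineq1101_regionA,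
tower_iff_lev_eq, le_lev_iff}` (F1, USED), `B8Eq1101CubeMemberCutoffs.*` (F4a, USED), `B8Eq1101CubeMemberWeights.*` (F4e, USED), `B8Ineq198MultiLevelBox.
ineq1101_multiLevelBox` (r05, USED at exponent 4), `B8Eq192CubeMemberOfReal1G.real2_of_real1_gbound` (F6, the consumer of §4∕§5's shape; not imported).
-/
noncomputable section

namespace Literature.MathematicalPhysics.QuantumFieldTheory.Balaban1983to89.B8Eq1101CubeMemberRealM4

open scoped Matrix
open B6MultiLevelBoxOperator (Domains N0 mlOp gml levC)
open B6Prop22DerivMultiLevelBox (dMat)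
open B6Ineq243TwoLevelBox (aNext)
open B4Reflection242 (boxDom mem_boxDom blk)
open B7Prop1Explicit (e)
open B8Eq131Cubes (l1dist cube)
open B8Eq131CubesAdmissible (cubeFam cubeFam_false_of_le)
open B8CubeMemberZd (cubeLamS)
open B8Eq191FlatDirichletDepth (depth depth_ge_of_mem_inner mem_cube_of_tower)
open B8CubeMemberBoxDomains (shift boxP lev cubeDomains lev_le tower_iff_lev_eq)
open B8Ineq198MultiLevelBox (ineq1101_multiLevelBox)
open B8Eq1101CubeMemberCutoffs (cutA cutAt cutB cutBt cut_mem cutAt_eq_of_depth cutBt_facts abs_depth_sub_le_l1dist l1dist_le_of_blockMap_eq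
  blockMap_pow_zero)
open B8Eq1101CubeMemberParametrixIdentity (mem_cube_one_of_cutA_ne_zero)
open B8Eq191FlatDirichletWall (abs_l1dist_step_le l1dist_self l1dist_nonneg)
open Literature.MathematicalPhysics.QuantumLattice (blockMap)

variable {d : ℕ}

/-! ## §1 Region A at a general weight exponent (r05's (1.101) on p21's Neumann box, read at the cube member) -/

/-- **REGION A, GENERAL EXPONENT** — r05's `B8Ineq198MultiLevelBox.ineq1101_multiLevelBox` (the function and gradient members of [Balaban1984PropagatorsII] Prop. 2.2 ∕
[Balaban1985RegularSpaces] (1.101) on p21's Neumann multi-level box, sources weighted by `(L^{lev})^{−m}`) READ AT THE CUBE MEMBER `cubeDomains` (F1): outputs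
`|(G′f)(x)| ≤ C′(L^{lev x})²(L^{lev x})^{−m}S`, `|(∂_μG′f)(x)| ≤ C′L^{lev x}(L^{lev x})^{−m}S`.  Nothing new is proved: this is the cited theorem, by `exact`.
[cite: Balaban1985RegularSpaces, (1.101) p.93, p.98; Balaban1985BackgroundPropagators, Theorem 3.1 (3.47) p.398 («for γ ∈ [−4, 4]»); Balaban1984PropagatorsII, Prop. 2.2 (2.67) p.234] -/
theorem ineq1101_regionA_pow (d ℓ : ℕ) (hℓ : 1 ≤ ℓ) (aminus aplus a2minus a2plus : ℝ) (ha : 0 < aminus) (ha2 : 0 < a2minus) (m : ℕ) :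
    ∃ C' M₀ : ℝ, ∃ N₀ : ℕ, 0 < C' ∧ 0 < M₀ ∧ 0 < N₀ ∧
      ∀ (Mh : ℕ) (_hMh : 3 ≤ Mh), M₀ ≤ ((ℓ : ℝ) + 1) * Mh →
      ∀ (a : Fin (d + 1) → ℤ) (M ρ k n R : ℕ) (hn : 1 ≤ n) (hnk : n ≤ k) (hρ : Mh * (ℓ + 1) ∣ ρ) (hM : Mh * (ℓ + 1) ∣ M)
        (hρ0 : 0 < ρ) (hR : R * (Mh * (ℓ + 1)) ≤ ρ), 2 * (ℓ + 1) ≤ R → N₀ + 1 ≤ R * ((ℓ + 1) * Mh) →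
      ∀ (aw c : ℕ → ℝ), (∀ i, 1 ≤ i → aminus ≤ aw i ∧ aw i ≤ aplus) → (∀ i, 1 ≤ i → a2minus ≤ c i ∧ c i ≤ a2plus) →
        (∀ i, 1 ≤ i → aw (i + 1) = aNext ℓ (aw i) (c i)) →
        ∀ (f : ↥(boxDom (N0 ℓ Mh n (boxP ℓ M ρ k n))) → ℝ) (S : ℝ), 0 ≤ S →
          (∀ z : ↥(boxDom (N0 ℓ Mh n (boxP ℓ M ρ k n))), |f z| ≤ S * ((((ℓ : ℝ) + 1) ^ lev ℓ Mh a M ρ k n z.1) ^ m)⁻¹) →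
          ∀ x : ↥(boxDom (N0 ℓ Mh n (boxP ℓ M ρ k n))),
            |(gml (N0 ℓ Mh n (boxP ℓ M ρ k n)) ℓ n (lev ℓ Mh a M ρ k n) aw *ᵥ f) x| ≤
              C' * (((ℓ : ℝ) + 1) ^ lev ℓ Mh a M ρ k n x.1) ^ 2 * ((((ℓ : ℝ) + 1) ^ lev ℓ Mh a M ρ k n x.1) ^ m)⁻¹ * S ∧
            (∀ μ : Fin (d + 1), |(dMat (N0 ℓ Mh n (boxP ℓ M ρ k n)) μ *ᵥ
                (gml (N0 ℓ Mh n (boxP ℓ M ρ k n)) ℓ n (lev ℓ Mh a M ρ k n) aw *ᵥ f)) x| ≤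
              C' * ((ℓ : ℝ) + 1) ^ lev ℓ Mh a M ρ k n x.1 * ((((ℓ : ℝ) + 1) ^ lev ℓ Mh a M ρ k n x.1) ^ m)⁻¹ * S) := by
  obtain ⟨C', M₀, N₀, hC', hM₀, hN₀, h⟩ := ineq1101_multiLevelBox d ℓ hℓ aminus aplus a2minus a2plus ha ha2 m
  refine ⟨C', M₀, N₀, hC', hM₀, hN₀, ?_⟩
  intro Mh hMh hM0 a M ρ k n R hn hnk hρ hM hρ0 hR hR2 hRN aw c haw hc hrec f S hS hf x
  have hP : ∀ μ : Fin (d + 1), 1 ≤ boxP (d := d) ℓ M ρ k n μ := fun μ => le_trans hρ0 (Nat.le_add_right _ _)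
  obtain ⟨h1, h2, -, -⟩ := h n Mh R hMh hM0 hR2 hRN (boxP ℓ M ρ k n) hP (cubeDomains (by omega) a hn hnk hρ hM hρ0 hR) aw c haw hc hrec
    f S hS hf x
  exact ⟨h1, h2⟩

/-! ## §2 Region A input∕output at exponent 4: `(Lʲη)⁴`-bounded sources, `(Lʲη)²`-weighted output -/

open Classical in
/-- **REGION A AT EXPONENT 4.**  For a source `u` with `(Lʲη)⁴|u| ≤ N` on `□_j` (`j ≤ n`), the truncated and translated source `u_A(y) = h_A(y − t)u(y − t)` on
p21's box satisfies `|u_A(y)| ≤ Nη⁻⁴(L^{lev y})⁻⁴`, hence region A's output obeys `η⁴(L^{lev y})²|(G′u_A)(y)| ≤ C′N` (the `(−4) → (−2)` mapping of (3.47)).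
[cite: Balaban1985RegularSpaces, (1.101) p.93, p.98; Balaban1985BackgroundPropagators, (3.47) p.398; Balaban1984PropagatorsII, Prop. 2.2 (2.67) p.234] -/
theorem regionA_bounds4 {ℓ Mh : ℕ} (hMh : 1 ≤ Mh) (a : Fin (d + 1) → ℤ) {M ρ k n : ℕ} (hn : 1 ≤ n) (hnk : n ≤ k)
    (hρd : Mh * (ℓ + 1) ∣ ρ) (hρ0 : 0 < ρ)
    {η : ℝ} (hη : 0 < η) (aw : ℕ → ℝ) {C' : ℝ}
    (hG : ∀ (f : ↥(boxDom (N0 ℓ Mh n (boxP ℓ M ρ k n))) → ℝ) (S' : ℝ), 0 ≤ S' →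
      (∀ z : ↥(boxDom (N0 ℓ Mh n (boxP ℓ M ρ k n))), |f z| ≤ S' * ((((ℓ : ℝ) + 1) ^ lev ℓ Mh a M ρ k n z.1) ^ 4)⁻¹) →
      ∀ y : ↥(boxDom (N0 ℓ Mh n (boxP ℓ M ρ k n))),
        |(gml (N0 ℓ Mh n (boxP ℓ M ρ k n)) ℓ n (lev ℓ Mh a M ρ k n) aw *ᵥ f) y| ≤
          C' * (((ℓ : ℝ) + 1) ^ lev ℓ Mh a M ρ k n y.1) ^ 2 * ((((ℓ : ℝ) + 1) ^ lev ℓ Mh a M ρ k n y.1) ^ 4)⁻¹ * S')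
    {s : ℕ} (hs : 1 ≤ s) (u : (Fin (d + 1) → ℤ) → ℝ) {N : ℝ} (hN : 0 ≤ N)
    (hu : ∀ j, j ≤ n → ∀ z, z ∈ cube (ℓ + 1) a M ρ k j → ((((ℓ + 1 : ℕ) : ℝ)) ^ j * η) ^ 4 * |u z| ≤ N)
    (uA : ↥(boxDom (N0 ℓ Mh n (boxP ℓ M ρ k n))) → ℝ)
    (huA : ∀ y, uA y = cutA (Nat.succ_pos d) (ℓ + 1) a M ρ k s (y.1 - shift ℓ Mh a ρ k n) * u (y.1 - shift ℓ Mh a ρ k n))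
    (y : ↥(boxDom (N0 ℓ Mh n (boxP ℓ M ρ k n)))) :
    η ^ 4 * (((ℓ : ℝ) + 1) ^ lev ℓ Mh a M ρ k n y.1) ^ 2 * |(gml (N0 ℓ Mh n (boxP ℓ M ρ k n)) ℓ n (lev ℓ Mh a M ρ k n) aw *ᵥ uA) y|
      ≤ C' * N := by
  have hL : 1 ≤ ℓ + 1 := Nat.succ_pos ℓ
  have hk : 1 ≤ k := hn.trans hnk
  have hρL : ℓ + 1 ≤ ρ := le_trans (Nat.le_mul_of_pos_left _ hMh) (Nat.le_of_dvd hρ0 hρd)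
  have hη4 : 0 < η ^ 4 := by positivity
  have hcast : ((ℓ + 1 : ℕ) : ℝ) = (ℓ : ℝ) + 1 := by push_cast; ring
  have hL0 : (0 : ℝ) < (ℓ : ℝ) + 1 := by positivity
  -- the input bound
  have huA' : ∀ z : ↥(boxDom (N0 ℓ Mh n (boxP ℓ M ρ k n))),
      |uA z| ≤ N * (η ^ 4)⁻¹ * ((((ℓ : ℝ) + 1) ^ lev ℓ Mh a M ρ k n z.1) ^ 4)⁻¹ := by
    intro z
    rw [huA z]
    by_cases h0 : cutA (Nat.succ_pos d) (ℓ + 1) a M ρ k s (z.1 - shift ℓ Mh a ρ k n) = 0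
    · rw [h0, zero_mul, abs_zero]; positivity
    · have hz1 := mem_cube_one_of_cutA_ne_zero (Nat.succ_pos d) (ℓ + 1) a M ρ hs hk h0
      set j₀ := lev ℓ Mh a M ρ k n z.1 with hj₀
      have hj₀n : j₀ ≤ n := lev_le ℓ Mh a M ρ k hn _
      have hzt : z.1 - shift ℓ Mh a ρ k n + shift ℓ Mh a ρ k n = z.1 := sub_add_cancel _ _
      have htower : blockMap ((ℓ + 1) ^ j₀) (z.1 - shift ℓ Mh a ρ k n) ∈ cubeLamS (ℓ + 1) a M ρ k n j₀ := by
        rw [tower_iff_lev_eq a M hρL hn hnk hj₀n hz1 (Mh := Mh), hzt]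
      have hzj : z.1 - shift ℓ Mh a ρ k n ∈ cube (ℓ + 1) a M ρ k j₀ := mem_cube_of_tower hL a M ρ htower
      have hb := hu j₀ hj₀n _ hzj
      rw [hcast] at hb
      have hc := (cut_mem (Nat.succ_pos d) (ℓ + 1) a M ρ k s (z.1 - shift ℓ Mh a ρ k n)).1
      rw [abs_mul, abs_of_nonneg hc.1]
      have hpow : 0 < (((ℓ : ℝ) + 1) ^ j₀) ^ 4 := by positivity
      calc cutA (Nat.succ_pos d) (ℓ + 1) a M ρ k s (z.1 - shift ℓ Mh a ρ k n) * |u (z.1 - shift ℓ Mh a ρ k n)|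
          ≤ 1 * |u (z.1 - shift ℓ Mh a ρ k n)| := mul_le_mul_of_nonneg_right hc.2 (abs_nonneg _)
        _ ≤ N * (η ^ 4)⁻¹ * ((((ℓ : ℝ) + 1) ^ j₀) ^ 4)⁻¹ := by
            rw [one_mul, mul_assoc, ← mul_inv, le_mul_inv_iff₀ (by positivity)]
            calc |u (z.1 - shift ℓ Mh a ρ k n)| * (η ^ 4 * (((ℓ : ℝ) + 1) ^ j₀) ^ 4)
                = (((ℓ : ℝ) + 1) ^ j₀ * η) ^ 4 * |u (z.1 - shift ℓ Mh a ρ k n)| := by ring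
              _ ≤ N := hb
  have h1 := hG uA (N * (η ^ 4)⁻¹) (by positivity) huA' y
  set lam : ℝ := ((ℓ : ℝ) + 1) ^ lev ℓ Mh a M ρ k n y.1 with hlam
  have hlam0 : 0 < lam := by rw [hlam]; positivity
  calc η ^ 4 * lam ^ 2 * |(gml (N0 ℓ Mh n (boxP ℓ M ρ k n)) ℓ n (lev ℓ Mh a M ρ k n) aw *ᵥ uA) y|
      ≤ η ^ 4 * lam ^ 2 * (C' * lam ^ 2 * (lam ^ 4)⁻¹ * (N * (η ^ 4)⁻¹)) := mul_le_mul_of_nonneg_left h1 (by positivity)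
    _ = C' * N := by field_simp

/-! ## §3 The commutator vanishes on `□₂` -/

open Classical in
/-- **THE COMMUTATOR ROW VANISHES AT THE SITES OF `□₂`** (`4s + (d+1)ℓ ≤ ρL`, `k ≥ 2`): for `x ∈ □₂` every entry `K(x,z)` of the row meets a vanishing
difference of cutoffs — the site, its lattice neighbours and its tower block (of level `J ≥ 2`, inside `□_J ⊂ □₂`; of level `1`, within `|·|₁`-distance `(d+1)ℓ`)
are all at depth `≥ 4s` into `□₁`, where `h̃_A ≡ 1` and `h̃_B ≡ 0`.
[cite: Balaban1984PropagatorsII, (2.52)–(2.55) p.232–233, (2.48) p.231; Balaban1985RegularSpaces, (1.101) p.93, (1.131) p.99] -/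
theorem commutator_vanish_deep {ℓ : ℕ} (a : Fin (d + 1) → ℤ) (M : ℕ) {ρ k n : ℕ} (hρL : ℓ + 1 ≤ ρ) (hnk : n ≤ k) (hk2 : 2 ≤ k)
    {η : ℝ} (w : ℕ → ℝ) (K : (Fin (d + 1) → ℤ) → (Fin (d + 1) → ℤ) → ℝ)
    (hK : ∀ x z, K x z = ((η ^ 2)⁻¹ * ∑ μ : Fin (d + 1), ((2 : ℝ) * (if z = x then (1 : ℝ) else 0) - (if z = x + e μ then (1 : ℝ) else 0)
        - (if z = x - e μ then (1 : ℝ) else 0))) +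
        (∑ j ∈ Finset.range (n + 1), (if blockMap ((ℓ + 1) ^ j) x ∈ cubeLamS (ℓ + 1) a M ρ k n j ∧
            blockMap ((ℓ + 1) ^ j) z = blockMap ((ℓ + 1) ^ j) x then
          w j * (((((ℓ + 1 : ℕ) : ℝ) ^ (d + 1))⁻¹) ^ j) ^ 2 else 0)))
    (S : Finset (Fin (d + 1) → ℤ))
    {s : ℕ} (hs : 1 ≤ s) (hs4 : 4 * s + (d + 1) * ℓ ≤ ρ * (ℓ + 1))
    (gAx gBx : (Fin (d + 1) → ℤ) → ℝ) {x : Fin (d + 1) → ℤ} (hx2 : x ∈ cube (ℓ + 1) a M ρ k 2) :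
    ∑ z ∈ S, K x z * ((cutAt (Nat.succ_pos d) (ℓ + 1) a M ρ k s z - cutAt (Nat.succ_pos d) (ℓ + 1) a M ρ k s x) * (η ^ 2 * gAx z)
        + (cutBt (Nat.succ_pos d) (ℓ + 1) a M ρ k s z - cutBt (Nat.succ_pos d) (ℓ + 1) a M ρ k s x) * gBx z) = 0 := by
  have hd : 0 < d + 1 := Nat.succ_pos d
  have hL : 1 ≤ ℓ + 1 := Nat.succ_pos ℓ
  -- depths: `x` is deeper than `ρL ≥ 4s + (d+1)ℓ`
  have hs4z : 4 * (s : ℤ) + (d + 1 : ℕ) * (ℓ : ℤ) ≤ (ρ : ℤ) * (ℓ + 1 : ℕ) := by exact_mod_cast hs4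
  have hdx : (ρ : ℤ) * (ℓ + 1 : ℕ) + 1 ≤ depth hd (ℓ + 1) a M ρ k 1 x := by
    have h := depth_ge_of_mem_inner hd a M ρ (show 1 < 2 by norm_num) hk2 hx2 (L := ℓ + 1)
    simpa using h
  have hcutx : cutAt hd (ℓ + 1) a M ρ k s x = 1 ∧ cutBt hd (ℓ + 1) a M ρ k s x = 0 :=
    ⟨(cutAt_eq_of_depth hd (ℓ + 1) a M ρ k hs x).1 (by push_cast at hs4z hdx ⊢; nlinarith),
     (cutBt_facts hd (ℓ + 1) a M ρ k hs x).2.2.1 (by push_cast at hs4z hdx ⊢; nlinarith)⟩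
  -- a site at depth `≥ 4s` has the same cutoff values, so the integrand vanishes there
  have hcz : ∀ z, 4 * (s : ℤ) ≤ depth hd (ℓ + 1) a M ρ k 1 z →
      (cutAt hd (ℓ + 1) a M ρ k s z - cutAt hd (ℓ + 1) a M ρ k s x) * (η ^ 2 * gAx z)
        + (cutBt hd (ℓ + 1) a M ρ k s z - cutBt hd (ℓ + 1) a M ρ k s x) * gBx z = 0 := by
    intro z hz
    have h1 : cutAt hd (ℓ + 1) a M ρ k s z = 1 := (cutAt_eq_of_depth hd (ℓ + 1) a M ρ k hs z).1 (by linarith)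
    have h3 : cutBt hd (ℓ + 1) a M ρ k s z = 0 := (cutBt_facts hd (ℓ + 1) a M ρ k hs z).2.2.1 hz
    rw [h1, h3, hcutx.1, hcutx.2, sub_self, sub_self, zero_mul, zero_mul, add_zero]
  -- an entry `K(x,z) ≠ 0` forces `z` to be the site, a neighbour, or a tower-block mate
  have hKzero : ∀ z, z ≠ x → (∀ μ : Fin (d + 1), z ≠ x + e μ ∧ z ≠ x - e μ) →
      (∀ j', j' ≤ n → blockMap ((ℓ + 1) ^ j') x ∈ cubeLamS (ℓ + 1) a M ρ k n j' → blockMap ((ℓ + 1) ^ j') z ≠ blockMap ((ℓ + 1) ^ j') x) →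
      K x z = 0 := by
    intro z h1 h2 h3
    rw [hK]
    have hA : ∑ μ : Fin (d + 1), ((2 : ℝ) * (if z = x then (1 : ℝ) else 0) - (if z = x + e μ then (1 : ℝ) else 0)
        - (if z = x - e μ then (1 : ℝ) else 0)) = 0 :=
      Finset.sum_eq_zero fun μ _ => by rw [if_neg h1, if_neg (h2 μ).1, if_neg (h2 μ).2]; ring
    have hB : ∑ j ∈ Finset.range (n + 1), (if blockMap ((ℓ + 1) ^ j) x ∈ cubeLamS (ℓ + 1) a M ρ k n j ∧
        blockMap ((ℓ + 1) ^ j) z = blockMap ((ℓ + 1) ^ j) x then w j * (((((ℓ + 1 : ℕ) : ℝ) ^ (d + 1))⁻¹) ^ j) ^ 2 else 0) = 0 :=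
      Finset.sum_eq_zero fun j hj => by
        rw [if_neg]
        rintro ⟨ht, hb⟩
        exact h3 j (Nat.lt_succ_iff.mp (Finset.mem_range.mp hj)) ht hb
    rw [hA, hB, mul_zero, add_zero]
  -- every `z ∈ S` with `K(x,z) ≠ 0` is at depth `≥ 4s`
  have hdeepz : ∀ z ∈ S, K x z ≠ 0 → 4 * (s : ℤ) ≤ depth hd (ℓ + 1) a M ρ k 1 z := by
    intro z hzS hne
    by_contra hlt
    push Not at hlt
    apply hne
    refine hKzero z ?_ ?_ ?_
    · rintro rfl; push_cast at hs4z hdx hlt; nlinarith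
    · intro μ
      have hstep := abs_l1dist_step_le x x μ
      rw [l1dist_self] at hstep
      constructor
      · rintro rfl
        have h := abs_depth_sub_le_l1dist hd (ℓ + 1) a M ρ k 1 (x + e μ) x
        have hl : l1dist (x + e μ) x ≤ 1 := by have := hstep.1; rw [sub_zero] at this; exact (le_abs_self _).trans this
        have := (abs_le.mp (h.trans hl)).1
        push_cast at hs4z hdx hlt; nlinarith
      · rintro rfl
        have h := abs_depth_sub_le_l1dist hd (ℓ + 1) a M ρ k 1 (x - e μ) x
        have hl : l1dist (x - e μ) x ≤ 1 := by have := hstep.2; rw [sub_zero] at this; exact (le_abs_self _).trans this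
        have := (abs_le.mp (h.trans hl)).1
        push_cast at hs4z hdx hlt; nlinarith
    · intro j' hj'n ht hb
      -- `z` lies in the tower block of `x` at level `j'`
      have hzj' : z ∈ cube (ℓ + 1) a M ρ k j' := mem_cube_of_tower hL a M ρ (by rw [hb]; exact ht)
      rcases Nat.lt_or_ge j' 2 with hj'2 | hj'2
      · -- level `≤ 1`: same `L^{j'}`-block, `|z − x|₁ ≤ (d+1)(L^{j'} − 1) ≤ (d+1)ℓ`
        interval_cases j'
        · rw [blockMap_pow_zero, blockMap_pow_zero] at hb
          subst hb
          push_cast at hs4z hdx hlt; nlinarith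
        · rw [pow_one] at hb
          have hl := l1dist_le_of_blockMap_eq hL hb
          have h := abs_depth_sub_le_l1dist hd (ℓ + 1) a M ρ k 1 z x
          have := (abs_le.mp (h.trans hl)).1
          push_cast at hs4z hdx hlt this; nlinarith
      · -- level `≥ 2`: `z ∈ □_{j'} ⊆ □₂`, depth `≥ ρL + 1`
        have hz2 : z ∈ cube (ℓ + 1) a M ρ k 2 := by
          have hsub := B8Eq191FlatLettersCubeMember.cubeFam_antitone hL a M hρL k hj'2
          rw [cubeFam_false_of_le _ a M ρ (hj'n.trans hnk), cubeFam_false_of_le _ a M ρ hk2] at hsub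
          exact hsub hzj'
        have h := depth_ge_of_mem_inner hd a M ρ (show 1 < 2 by norm_num) hk2 hz2 (L := ℓ + 1)
        simp only [pow_one] at h
        push_cast at hs4z hlt h; nlinarith
  -- conclusion
  refine Finset.sum_eq_zero fun z hz => ?_
  by_cases hKz : K x z = 0
  · rw [hKz, zero_mul]
  · rw [hcz z (hdeepz z hz hKz), mul_zero]

/-! ## §4 (1.101) at exponent `−4 → −2` on the cube member: the function member (REAL-1′ of `B8Eq192CubeMemberOfReal1G`) -/

open B8LambdaSpaceKLevel (wt)
open B8Eq191FlatDirichletForm (isUnit_flatMatrix)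
open B8CubeMemberBoxDomains (le_lev_iff one_le_lev)
open B8Eq1101CubeMemberCutoffs (wall wall_subset)
open B8Eq1101CubeMemberParametrixIdentity (parametrix_identity regionB_bound commutator_bound)
open B8Eq1101CubeMemberReal (apriori_functional_bound dite_shift_apply)

set_option maxHeartbeats 400000 in
open Classical in
/-- **[Balaban1985RegularSpaces] (1.101) AT `U₀ = 1` ON THE CUBE MEMBER, EXPONENT `−4 → −2` — THE HYPOTHESIS REAL-1′ OF `B8Eq192CubeMemberOfReal1G.real2_of_real1_gbound`**
([4] (3.47) «|G′(U)λ|₍₂₊γ₎ ≦ B₀|λ|₍γ₎ … for γ ∈ [−4, 4]» at `γ = −4`, function member).  Same data regime and weight hypotheses as F4c∕F4d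
(`B8Eq1101CubeMemberReal.ineq1101_cubeMember_sup`; the collar threshold `ρ₀` is larger: the smallness of the commutator in the `(−4)`-weighted norm costs a
factor `L²`).  For every source `u` on `□₀` with `(Lʲη)⁴|u| ≤ r` on `□_j` (`j ≤ n`): `(Lʲη)²|(T⁻¹u)(v)| ≤ B_G′·r` for `v ∈ □_j`.  PROOF: the two-region parametrix
`T·P = 1 + K₁` of F4b; region A at exponent 4 (§2, r05's general-exponent (1.101)); the wall at exponent 2 with `N ↦ Nη⁻²` (levels `≤ 1`); `K₁u` VANISHES on `□₂`
(§3) and is `≤ 10(d+1)L⁴(C′ + C_W)∕s`-small in the `(−4)`-norm at levels `≤ 1`; a-priori inversion (F4c §1) of the weighted functional `u ↦ (Lʲη)²(T⁻¹u)(v)`.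
[cite: Balaban1985RegularSpaces, (1.101) p.93, p.98, (1.131) p.99; Balaban1985BackgroundPropagators, Theorem 3.1 (3.47) p.398; Balaban1984PropagatorsII, (2.47)–(2.58) p.231–233, Prop. 2.2 (2.67) p.234] -/
theorem ineq1101_cubeMember_m4 (d ℓ : ℕ) (hℓ : 1 ≤ ℓ) :
    ∃ BG ρ₀ M₀ : ℝ, ∃ N₀ : ℕ, 0 < BG ∧ 0 < M₀ ∧ 0 < N₀ ∧
      ∀ (η : ℝ), 0 < η → ∀ (Mh : ℕ), 3 ≤ Mh → M₀ ≤ ((ℓ : ℝ) + 1) * Mh →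
      ∀ (a : Fin (d + 1) → ℤ) (M ρ k n R : ℕ), 1 ≤ n → n ≤ k → Mh * (ℓ + 1) ∣ ρ → Mh * (ℓ + 1) ∣ M → 0 < ρ →
        R * (Mh * (ℓ + 1)) ≤ ρ → 2 * (ℓ + 1) ≤ R → N₀ + 1 ≤ R * ((ℓ + 1) * Mh) → ρ₀ ≤ (ρ : ℝ) →
      ∀ (aw c : ℕ → ℝ), (∀ i, 1 ≤ i → 4 ≤ aw i ∧ aw i ≤ 8) → (∀ i, 1 ≤ i → 4 ≤ c i ∧ c i ≤ 8) →
        (∀ i, 1 ≤ i → aw (i + 1) = aNext ℓ (aw i) (c i)) → (∀ j, 0 < aw j) →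
      ∀ (w : ℕ → ℝ), (∀ j, 0 < w j) →
        (∀ j, 1 ≤ j → j ≤ n → w j * (((((ℓ + 1 : ℕ) : ℝ) ^ (d + 1))⁻¹) ^ j) ^ 2 = (η ^ 2)⁻¹ * levC d ℓ aw j) →
        (∀ j, j ≤ n → 4 ≤ w j * η ^ 2 * (((ℓ + 1 : ℕ) : ℝ) ^ j) ^ 2 * (((((ℓ + 1 : ℕ) : ℝ)) ^ (d + 1)) ^ j)⁻¹ ∧
          w j * η ^ 2 * (((ℓ + 1 : ℕ) : ℝ) ^ j) ^ 2 * (((((ℓ + 1 : ℕ) : ℝ)) ^ (d + 1)) ^ j)⁻¹ ≤ 8) →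
      ∀ (S : Finset (Fin (d + 1) → ℤ)), (∀ z, z ∈ S ↔ z ∈ cubeFam false (ℓ + 1) a M ρ k 0) →
      ∀ (K : (Fin (d + 1) → ℤ) → (Fin (d + 1) → ℤ) → ℝ), (∀ x z, K x z =
          ((η ^ 2)⁻¹ * ∑ μ : Fin (d + 1), ((2 : ℝ) * (if z = x then (1 : ℝ) else 0) - (if z = x + e μ then (1 : ℝ) else 0)
            - (if z = x - e μ then (1 : ℝ) else 0))) +
          (∑ j ∈ Finset.range (n + 1), (if blockMap ((ℓ + 1) ^ j) x ∈ cubeLamS (ℓ + 1) a M ρ k n j ∧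
              blockMap ((ℓ + 1) ^ j) z = blockMap ((ℓ + 1) ^ j) x then
            w j * (((((ℓ + 1 : ℕ) : ℝ) ^ (d + 1))⁻¹) ^ j) ^ 2 else 0))) →
      ∀ (T : Matrix ↥S ↥S ℝ), T = Matrix.of (fun x z : ↥S => K x.1 z.1) →
      ∀ (u : ↥S → ℝ) (r : ℝ), 0 ≤ r →
        (∀ j, j ≤ n → ∀ z : ↥S, z.1 ∈ cubeFam false (ℓ + 1) a M ρ k j → wt (ℓ + 1) η j ^ 4 * |u z| ≤ r) →
        ∀ j, j ≤ n → ∀ v : ↥S, v.1 ∈ cubeFam false (ℓ + 1) a M ρ k j →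
          wt (ℓ + 1) η j ^ 2 * |∑ z : ↥S, T⁻¹ v z * u z| ≤ BG * r := by
  have hd : 0 < d + 1 := Nat.succ_pos d
  have hL : 1 ≤ ℓ + 1 := Nat.succ_pos ℓ
  have hLr : (1 : ℝ) ≤ ((ℓ + 1 : ℕ) : ℝ) := by exact_mod_cast hL
  have hLpos : (0 : ℝ) < ((ℓ + 1 : ℕ) : ℝ) := by positivity
  have hcast : ((ℓ + 1 : ℕ) : ℝ) = (ℓ : ℝ) + 1 := by push_cast; ring
  -- region A's (1.101) package at exponent 4 (p21 ∕ r05 via §1), weight windows `[4, 8]`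
  obtain ⟨C', M₀, N₀, hC', hM₀, hN₀, hregA⟩ := ineq1101_regionA_pow d ℓ hℓ 4 8 4 8 (by norm_num) (by norm_num) 4
  -- the wall constant (F3 at `a₀ = 4`, `θ = ½`, `δ′ = 1/(2(d+1))`)
  set CW : ℝ := (((ℓ + 1 : ℕ) : ℝ)) ^ 2 / (4 * (1 - 1 / 2)) * B6.c0 1 (1 / (2 * ((d : ℝ) + 1)) / ((ℓ + 1 : ℕ) : ℝ)) ^ (d + 1) with hCW
  have hc0 : 1 ≤ B6.c0 1 (1 / (2 * ((d : ℝ) + 1)) / ((ℓ + 1 : ℕ) : ℝ)) := B8Eq191FlatDirichletWall.one_le_c0 (by positivity)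
  have hCW0 : 0 ≤ CW := by rw [hCW]; have := hc0; positivity
  -- the ramp-length threshold (a factor `L²` larger than at exponent 2) and the collar threshold
  set s₀ : ℝ := 20 * ((d : ℝ) + 1) * (((ℓ + 1 : ℕ) : ℝ)) ^ 4 * (C' + CW) with hs₀
  have hs₀0 : 0 ≤ s₀ := by rw [hs₀]; positivity
  set ρ₀ : ℝ := 4 * s₀ + 12 + ((d : ℝ) + 1) * ℓ with hρ₀
  refine ⟨2 * (C' + (((ℓ + 1 : ℕ) : ℝ)) ^ 2 * CW), ρ₀, M₀, N₀, by positivity, hM₀, hN₀, ?_⟩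
  intro η hη Mh hMh hM0 a M ρ k n R hn hnk hρd hMd hρ0 hR hR2 hRN hρbig aw c haw hc hrec hawpos w hwpos hw hwin S hS K hK T hT
    u₁ r hr hu₁ j₀ hj₀ v hv
  have hη0 : η ≠ 0 := hη.ne'
  have hη2 : 0 < η ^ 2 := by positivity
  have hMh1 : 1 ≤ Mh := le_trans (by norm_num) hMh
  have hk : 1 ≤ k := hn.trans hnk
  have hρL : ℓ + 1 ≤ ρ := le_trans (Nat.le_mul_of_pos_left _ hMh1) (Nat.le_of_dvd hρ0 hρd)
  -- the ramp length `s` and the wall parameter `m_W = 4s`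
  obtain ⟨s, hs⟩ : ∃ s : ℕ, s = (ρ * (ℓ + 1) - (d + 1) * ℓ) / 4 := ⟨_, rfl⟩
  have hρL' : (d + 1) * ℓ + 4 * (Nat.ceil s₀ + 1) ≤ ρ * (ℓ + 1) := by
    have h1 : (ρ : ℝ) ≤ (ρ : ℝ) * ((ℓ + 1 : ℕ) : ℝ) := le_mul_of_one_le_right (by positivity) hLr
    have h2 : ((Nat.ceil s₀ : ℕ) : ℝ) < s₀ + 1 := Nat.ceil_lt_add_one hs₀0
    have h3 : (((d + 1) * ℓ + 4 * (Nat.ceil s₀ + 1) : ℕ) : ℝ) ≤ ((ρ * (ℓ + 1) : ℕ) : ℝ) := by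
      push_cast; rw [hρ₀] at hρbig; push_cast at h1; nlinarith
    exact_mod_cast h3
  have hs_ge : Nat.ceil s₀ + 1 ≤ s := by
    rw [hs, Nat.le_div_iff_mul_le (by norm_num)]; omega
  have hs1 : 1 ≤ s := le_trans (by omega) hs_ge
  have hss₀ : s₀ ≤ s := (Nat.le_ceil s₀).trans (by exact_mod_cast (by omega : Nat.ceil s₀ ≤ s))
  have hs4 : 4 * s + (d + 1) * ℓ ≤ ρ * (ℓ + 1) := by
    rw [hs]; have := Nat.div_mul_le_self (ρ * (ℓ + 1) - (d + 1) * ℓ) 4; omega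
  have hmWρ : ((4 * s : ℕ) : ℤ) + (d + 1 : ℕ) * ((ℓ + 1 : ℕ) - 1 : ℤ) ≤ ρ * (ℓ + 1 : ℕ) := by
    have : (((4 * s + (d + 1) * ℓ : ℕ)) : ℤ) ≤ ((ρ * (ℓ + 1) : ℕ) : ℤ) := by exact_mod_cast hs4
    push_cast at this ⊢; linarith
  have hρs : 4 * (s : ℤ) ≤ ρ * (ℓ + 1 : ℕ) := by
    have : (((4 * s : ℕ)) : ℤ) ≤ ((ρ * (ℓ + 1) : ℕ) : ℤ) := by exact_mod_cast (le_trans (Nat.le_add_right _ _) hs4)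
    push_cast at this ⊢; linarith
  have hs0r : (0 : ℝ) < s := by exact_mod_cast hs1
  -- the `(−4)`-size predicate and the explicit operators of the parametrix, as functions of the source `u`
  obtain ⟨BW, hBW⟩ : ∃ BW : ((Fin (d + 1) → ℤ) → ℝ) → ℝ → Prop,
      ∀ u N, BW u N ↔ ∀ j, j ≤ n → ∀ z, z ∈ cube (ℓ + 1) a M ρ k j → ((((ℓ + 1 : ℕ) : ℝ)) ^ j * η) ^ 4 * |u z| ≤ N :=
    ⟨fun u N => ∀ j, j ≤ n → ∀ z, z ∈ cube (ℓ + 1) a M ρ k j → ((((ℓ + 1 : ℕ) : ℝ)) ^ j * η) ^ 4 * |u z| ≤ N, fun _ _ => Iff.rfl⟩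
  obtain ⟨uAf, huAf⟩ : ∃ uAf : ((Fin (d + 1) → ℤ) → ℝ) → ↥(boxDom (N0 ℓ Mh n (boxP ℓ M ρ k n))) → ℝ,
      ∀ u y, uAf u y = cutA hd (ℓ + 1) a M ρ k s (y.1 - shift ℓ Mh a ρ k n) * u (y.1 - shift ℓ Mh a ρ k n) := ⟨_, fun _ _ => rfl⟩
  obtain ⟨gAxf, hgAxf⟩ : ∃ gAxf : ((Fin (d + 1) → ℤ) → ℝ) → (Fin (d + 1) → ℤ) → ℝ,
      ∀ u z, gAxf u z = if h : z + shift ℓ Mh a ρ k n ∈ boxDom (N0 ℓ Mh n (boxP ℓ M ρ k n)) then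
        (gml (N0 ℓ Mh n (boxP ℓ M ρ k n)) ℓ n (lev ℓ Mh a M ρ k n) aw *ᵥ uAf u) ⟨z + shift ℓ Mh a ρ k n, h⟩ else 0 := ⟨_, fun _ _ => rfl⟩
  obtain ⟨uBf, huBf⟩ : ∃ uBf : ((Fin (d + 1) → ℤ) → ℝ) → ↥(wall hd (ℓ + 1) a M ρ k S (4 * s)) → ℝ,
      ∀ u y, uBf u y = cutB hd (ℓ + 1) a M ρ k s y.1 * u y.1 := ⟨_, fun _ _ => rfl⟩
  obtain ⟨gBxf, hgBxf⟩ : ∃ gBxf : ((Fin (d + 1) → ℤ) → ℝ) → (Fin (d + 1) → ℤ) → ℝ,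
      ∀ u z, gBxf u z = if h : z ∈ wall hd (ℓ + 1) a M ρ k S (4 * s) then
        (((Matrix.of fun x z : ↥(wall hd (ℓ + 1) a M ρ k S (4 * s)) => K x.1 z.1)⁻¹) *ᵥ uBf u) ⟨z, h⟩ else 0 := ⟨_, fun _ _ => rfl⟩
  obtain ⟨Pf, hPf⟩ : ∃ Pf : ((Fin (d + 1) → ℤ) → ℝ) → (Fin (d + 1) → ℤ) → ℝ,
      ∀ u z, Pf u z = cutAt hd (ℓ + 1) a M ρ k s z * (η ^ 2 * gAxf u z) + cutBt hd (ℓ + 1) a M ρ k s z * gBxf u z := ⟨_, fun _ _ => rfl⟩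
  obtain ⟨K₁, hK₁⟩ : ∃ K₁ : ((Fin (d + 1) → ℤ) → ℝ) → (Fin (d + 1) → ℤ) → ℝ,
      ∀ u x, K₁ u x = ∑ z ∈ S, K x z * ((cutAt hd (ℓ + 1) a M ρ k s z - cutAt hd (ℓ + 1) a M ρ k s x) * (η ^ 2 * gAxf u z)
        + (cutBt hd (ℓ + 1) a M ρ k s z - cutBt hd (ℓ + 1) a M ρ k s x) * gBxf u z) := ⟨_, fun _ _ => rfl⟩
  obtain ⟨ψ, hψ⟩ : ∃ ψ : ((Fin (d + 1) → ℤ) → ℝ) → (Fin (d + 1) → ℤ) → ℝ,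
      ∀ u x, ψ u x = if h : x ∈ S then ∑ z : ↥S, T⁻¹ ⟨x, h⟩ z * u z.1 else 0 := ⟨_, fun _ _ => rfl⟩
  -- facts about the explicit objects
  have hgAx_pull : ∀ u (y : ↥(boxDom (N0 ℓ Mh n (boxP ℓ M ρ k n)))),
      gAxf u (y.1 - shift ℓ Mh a ρ k n) = (gml (N0 ℓ Mh n (boxP ℓ M ρ k n)) ℓ n (lev ℓ Mh a M ρ k n) aw *ᵥ uAf u) y := by
    intro u y
    have h := dite_shift_apply (shift ℓ Mh a ρ k n) (gml (N0 ℓ Mh n (boxP ℓ M ρ k n)) ℓ n (lev ℓ Mh a M ρ k n) aw *ᵥ uAf u) y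
    rw [hgAxf]; exact h
  have hgBx_mem : ∀ u (y : ↥(wall hd (ℓ + 1) a M ρ k S (4 * s))),
      gBxf u y.1 = (((Matrix.of fun x z : ↥(wall hd (ℓ + 1) a M ρ k S (4 * s)) => K x.1 z.1)⁻¹) *ᵥ uBf u) y := by
    intro u y; rw [hgBxf, dif_pos y.2]
  have hgBx0 : ∀ u z, z ∉ wall hd (ℓ + 1) a M ρ k S (4 * s) → gBxf u z = 0 := by
    intro u z hz; rw [hgBxf, dif_neg hz]
  have hw0 : ∀ j, 0 ≤ w j := fun j => (hwpos j).le
  have hcubeS : ∀ j, j ≤ n → ∀ z, z ∈ cube (ℓ + 1) a M ρ k j → z ∈ S := by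
    intro j hj z hz
    have hsub := B8Eq191FlatLettersCubeMember.cubeFam_antitone hL a M hρL k (Nat.zero_le j)
    rw [cubeFam_false_of_le _ a M ρ (hj.trans hnk)] at hsub
    exact (hS z).mpr (hsub hz)
  -- (i) region A at exponent 4: the weighted output `η⁴(L^{lev y})²|G′u_A| ≤ C′N`
  have hregA' : ∀ (f : ↥(boxDom (N0 ℓ Mh n (boxP ℓ M ρ k n))) → ℝ) (S' : ℝ), 0 ≤ S' →
      (∀ z : ↥(boxDom (N0 ℓ Mh n (boxP ℓ M ρ k n))), |f z| ≤ S' * ((((ℓ : ℝ) + 1) ^ lev ℓ Mh a M ρ k n z.1) ^ 4)⁻¹) →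
      ∀ y : ↥(boxDom (N0 ℓ Mh n (boxP ℓ M ρ k n))),
        |(gml (N0 ℓ Mh n (boxP ℓ M ρ k n)) ℓ n (lev ℓ Mh a M ρ k n) aw *ᵥ f) y| ≤
          C' * (((ℓ : ℝ) + 1) ^ lev ℓ Mh a M ρ k n y.1) ^ 2 * ((((ℓ : ℝ) + 1) ^ lev ℓ Mh a M ρ k n y.1) ^ 4)⁻¹ * S' := by
    intro f S' hS' hf y
    exact (hregA Mh hMh hM0 a M ρ k n R hn hnk hρd hMd hρ0 hR hR2 hRN aw c haw hc hrec f S' hS' hf y).1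
  have hAw : ∀ u N, 0 ≤ N → BW u N → ∀ y : ↥(boxDom (N0 ℓ Mh n (boxP ℓ M ρ k n))),
      η ^ 4 * (((ℓ : ℝ) + 1) ^ lev ℓ Mh a M ρ k n y.1) ^ 2 *
        |(gml (N0 ℓ Mh n (boxP ℓ M ρ k n)) ℓ n (lev ℓ Mh a M ρ k n) aw *ᵥ uAf u) y| ≤ C' * N := by
    intro u N hN hu y
    rw [hBW] at hu
    exact regionA_bounds4 hMh1 a hn hnk hρd hρ0 hη aw hregA' hs1 u hN hu (uAf u) (huAf u) y
  -- the unweighted consequence `η²|gAx| ≤ C′Nη⁻²` (levels `≥ 1`)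
  have hAbound : ∀ u N, 0 ≤ N → BW u N → ∀ z, η ^ 2 * |gAxf u z| ≤ C' * N * (η ^ 2)⁻¹ := by
    intro u N hN hu z
    rw [hgAxf]
    split_ifs with h
    · have hb := hAw u N hN hu ⟨_, h⟩
      have hlam : (1 : ℝ) ≤ (((ℓ : ℝ) + 1) ^ lev ℓ Mh a M ρ k n (z + shift ℓ Mh a ρ k n)) ^ 2 :=
        one_le_pow₀ (one_le_pow₀ (by linarith [(Nat.cast_nonneg ℓ : (0 : ℝ) ≤ ℓ)]))
      rw [le_mul_inv_iff₀ hη2]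
      calc η ^ 2 * |(gml (N0 ℓ Mh n (boxP ℓ M ρ k n)) ℓ n (lev ℓ Mh a M ρ k n) aw *ᵥ uAf u) ⟨_, h⟩| * η ^ 2
          = η ^ 4 * 1 * |(gml (N0 ℓ Mh n (boxP ℓ M ρ k n)) ℓ n (lev ℓ Mh a M ρ k n) aw *ᵥ uAf u) ⟨_, h⟩| := by ring
        _ ≤ η ^ 4 * (((ℓ : ℝ) + 1) ^ lev ℓ Mh a M ρ k n (z + shift ℓ Mh a ρ k n)) ^ 2 *
              |(gml (N0 ℓ Mh n (boxP ℓ M ρ k n)) ℓ n (lev ℓ Mh a M ρ k n) aw *ᵥ uAf u) ⟨_, h⟩| :=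
            mul_le_mul_of_nonneg_right (mul_le_mul_of_nonneg_left hlam (by positivity)) (abs_nonneg _)
        _ ≤ C' * N := hb
    · rw [abs_zero, mul_zero]; positivity
  -- the weighted consequence at a site of `□_j ∩ □₁`: `(Lʲη)²·η²|gAx(x)| ≤ C′N`
  have hAweighted : ∀ u N, 0 ≤ N → BW u N → ∀ j, j ≤ n → ∀ x, x ∈ cube (ℓ + 1) a M ρ k j → x ∈ cube (ℓ + 1) a M ρ k 1 →
      ((((ℓ + 1 : ℕ) : ℝ)) ^ j * η) ^ 2 * (η ^ 2 * |gAxf u x|) ≤ C' * N := by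
    intro u N hN hu j hj x hxj hx1
    rw [hgAxf]
    split_ifs with h
    · have hb := hAw u N hN hu ⟨_, h⟩
      -- `j ≤ lev (x + t)`
      have hjlev : j ≤ lev ℓ Mh a M ρ k n (x + shift ℓ Mh a ρ k n) := by
        rcases Nat.eq_zero_or_pos j with hj0 | hjpos
        · rw [hj0]; exact Nat.zero_le _
        · exact (le_lev_iff a M hρL hnk hjpos hj (x + shift ℓ Mh a ρ k n) (Mh := Mh) (fun _ => by rw [add_sub_cancel_right]; exact hx1)).mpr
            (by rw [add_sub_cancel_right]; exact hxj)
      have hpowle : ((((ℓ + 1 : ℕ) : ℝ)) ^ j) ^ 2 ≤ (((ℓ : ℝ) + 1) ^ lev ℓ Mh a M ρ k n (x + shift ℓ Mh a ρ k n)) ^ 2 := by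
        rw [hcast]
        exact pow_le_pow_left₀ (by positivity) (pow_le_pow_right₀ (by linarith [(Nat.cast_nonneg ℓ : (0 : ℝ) ≤ ℓ)]) hjlev) 2
      calc ((((ℓ + 1 : ℕ) : ℝ)) ^ j * η) ^ 2 * (η ^ 2 * |(gml (N0 ℓ Mh n (boxP ℓ M ρ k n)) ℓ n (lev ℓ Mh a M ρ k n) aw *ᵥ uAf u) ⟨_, h⟩|)
          = η ^ 4 * ((((ℓ + 1 : ℕ) : ℝ)) ^ j) ^ 2 * |(gml (N0 ℓ Mh n (boxP ℓ M ρ k n)) ℓ n (lev ℓ Mh a M ρ k n) aw *ᵥ uAf u) ⟨_, h⟩| := by ring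
        _ ≤ η ^ 4 * (((ℓ : ℝ) + 1) ^ lev ℓ Mh a M ρ k n (x + shift ℓ Mh a ρ k n)) ^ 2 *
              |(gml (N0 ℓ Mh n (boxP ℓ M ρ k n)) ℓ n (lev ℓ Mh a M ρ k n) aw *ᵥ uAf u) ⟨_, h⟩| :=
            mul_le_mul_of_nonneg_right (mul_le_mul_of_nonneg_left hpowle (by positivity)) (abs_nonneg _)
        _ ≤ C' * N := hb
    · rw [abs_zero, mul_zero, mul_zero]; positivity
  -- (ii) the wall: `BW u N` gives the `(−2)`-bound with `Nη⁻²`, so `|gBx| ≤ C_W·Nη⁻²`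
  have hBW2 : ∀ u N, 0 ≤ N → BW u N →
      ∀ j, j ≤ n → ∀ z, z ∈ cube (ℓ + 1) a M ρ k j → ((((ℓ + 1 : ℕ) : ℝ)) ^ j * η) ^ 2 * |u z| ≤ N * (η ^ 2)⁻¹ := by
    intro u N hN hu j hj z hz
    rw [hBW] at hu
    have hb := hu j hj z hz
    have hLj : (1 : ℝ) ≤ (((ℓ + 1 : ℕ) : ℝ)) ^ j := one_le_pow₀ hLr
    rw [le_mul_inv_iff₀ hη2]
    calc ((((ℓ + 1 : ℕ) : ℝ)) ^ j * η) ^ 2 * |u z| * η ^ 2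
        = ((((ℓ + 1 : ℕ) : ℝ)) ^ j * η) ^ 2 * (1 * η) ^ 2 * |u z| := by ring
      _ ≤ ((((ℓ + 1 : ℕ) : ℝ)) ^ j * η) ^ 2 * ((((ℓ + 1 : ℕ) : ℝ)) ^ j * η) ^ 2 * |u z| := by
          refine mul_le_mul_of_nonneg_right (mul_le_mul_of_nonneg_left ?_ (by positivity)) (abs_nonneg _)
          rw [mul_pow, mul_pow, one_pow]
          exact mul_le_mul_of_nonneg_right (one_le_pow₀ hLj) (by positivity)
      _ = ((((ℓ + 1 : ℕ) : ℝ)) ^ j * η) ^ 4 * |u z| := by ring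
      _ ≤ N := hb
  have hBbound : ∀ u N, 0 ≤ N → BW u N → ∀ z, |gBxf u z| ≤ CW * (N * (η ^ 2)⁻¹) := by
    intro u N hN hu z
    rw [hgBxf]
    split_ifs with h
    · have hb := regionB_bound a M hρL hnk hη0 w hwpos K hK S hS (a₀ := 4) (by norm_num) (by norm_num)
        (fun j hj => (hwin j hj).1) (fun j hj => (hwin j hj).2) (s := s) (mW := 4 * s) hmWρ u (by positivity) (hBW2 u N hN hu)
        (uBf u) (huBf u) ⟨z, h⟩
      rw [hCW]; exact hb
    · rw [abs_zero]; positivity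
  -- (iii) the weighted bound of the parametrix: `(Lʲη)²|P u(x)| ≤ (C′ + L²C_W)N` on `□_j`
  have hPbound : ∀ u N, 0 ≤ N → BW u N → ∀ j, j ≤ n → ∀ x, x ∈ cube (ℓ + 1) a M ρ k j →
      ((((ℓ + 1 : ℕ) : ℝ)) ^ j * η) ^ 2 * |Pf u x| ≤ (C' + (((ℓ + 1 : ℕ) : ℝ)) ^ 2 * CW) * N := by
    intro u N hN hu j hj x hxj
    rw [hPf]
    obtain ⟨-, hAt, -, hBt⟩ := cut_mem hd (ℓ + 1) a M ρ k s x
    -- term A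
    have hA : ((((ℓ + 1 : ℕ) : ℝ)) ^ j * η) ^ 2 * |cutAt hd (ℓ + 1) a M ρ k s x * (η ^ 2 * gAxf u x)| ≤ C' * N := by
      by_cases h0 : cutAt hd (ℓ + 1) a M ρ k s x = 0
      · rw [h0, zero_mul, abs_zero, mul_zero]; positivity
      · have hx1 := (B8Eq1101CubeMemberCutoffs.depth_of_cutAt_ne_zero hd (ℓ + 1) a M ρ k hs1 hk h0).2.1
        have hb := hAweighted u N hN hu j hj x hxj hx1
        rw [abs_mul, abs_of_nonneg hAt.1, abs_mul, abs_of_nonneg hη2.le]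
        calc ((((ℓ + 1 : ℕ) : ℝ)) ^ j * η) ^ 2 * (cutAt hd (ℓ + 1) a M ρ k s x * (η ^ 2 * |gAxf u x|))
            ≤ ((((ℓ + 1 : ℕ) : ℝ)) ^ j * η) ^ 2 * (1 * (η ^ 2 * |gAxf u x|)) :=
              mul_le_mul_of_nonneg_left (mul_le_mul_of_nonneg_right hAt.2 (by positivity)) (by positivity)
          _ = ((((ℓ + 1 : ℕ) : ℝ)) ^ j * η) ^ 2 * (η ^ 2 * |gAxf u x|) := by rw [one_mul]
          _ ≤ C' * N := hb
    -- term B: `h̃_B(x) ≠ 0` forces depth `≤ 4s − 1`, hence `x ∉ □₂` and `j ≤ 1`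
    have hB : ((((ℓ + 1 : ℕ) : ℝ)) ^ j * η) ^ 2 * |cutBt hd (ℓ + 1) a M ρ k s x * gBxf u x| ≤ (((ℓ + 1 : ℕ) : ℝ)) ^ 2 * CW * N := by
      by_cases h0 : cutBt hd (ℓ + 1) a M ρ k s x = 0
      · rw [h0, zero_mul, abs_zero, mul_zero]; positivity
      · have hdepth := ((cutBt_facts hd (ℓ + 1) a M ρ k hs1 x).1 h0).2
        have hj1 : j ≤ 1 := by
          by_contra hj2
          push Not at hj2
          have hx2 : x ∈ cube (ℓ + 1) a M ρ k 2 := by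
            have hsub := B8Eq191FlatLettersCubeMember.cubeFam_antitone hL a M hρL k (Nat.succ_le_of_lt hj2)
            rw [cubeFam_false_of_le _ a M ρ (hj.trans hnk), cubeFam_false_of_le _ a M ρ (le_trans (Nat.succ_le_of_lt hj2) (hj.trans hnk))] at hsub
            exact hsub hxj
          have hge := depth_ge_of_mem_inner hd a M ρ (show 1 < 2 by norm_num) (le_trans (Nat.succ_le_of_lt hj2) (hj.trans hnk)) hx2 (L := ℓ + 1)
          simp only [pow_one] at hge
          have hs4z : 4 * (s : ℤ) + (d + 1 : ℕ) * (ℓ : ℤ) ≤ (ρ : ℤ) * (ℓ + 1 : ℕ) := by exact_mod_cast hs4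
          push_cast at hge hs4z hdepth
          nlinarith
        have hwle : ((((ℓ + 1 : ℕ) : ℝ)) ^ j * η) ^ 2 ≤ (((ℓ + 1 : ℕ) : ℝ)) ^ 2 * η ^ 2 := by
          rw [mul_pow]
          refine mul_le_mul_of_nonneg_right ?_ hη2.le
          rw [← pow_mul]
          exact pow_le_pow_right₀ hLr (by omega)
        have hgb := hBbound u N hN hu x
        rw [abs_mul, abs_of_nonneg hBt.1]
        calc ((((ℓ + 1 : ℕ) : ℝ)) ^ j * η) ^ 2 * (cutBt hd (ℓ + 1) a M ρ k s x * |gBxf u x|)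
            ≤ ((((ℓ + 1 : ℕ) : ℝ)) ^ 2 * η ^ 2) * (1 * (CW * (N * (η ^ 2)⁻¹))) :=
              mul_le_mul hwle (mul_le_mul hBt.2 hgb (abs_nonneg _) zero_le_one) (mul_nonneg hBt.1 (abs_nonneg _)) (by positivity)
          _ = (((ℓ + 1 : ℕ) : ℝ)) ^ 2 * CW * N * (η ^ 2 * (η ^ 2)⁻¹) := by ring
          _ = (((ℓ + 1 : ℕ) : ℝ)) ^ 2 * CW * N := by rw [mul_inv_cancel₀ hη2.ne', mul_one]
    calc ((((ℓ + 1 : ℕ) : ℝ)) ^ j * η) ^ 2 * |cutAt hd (ℓ + 1) a M ρ k s x * (η ^ 2 * gAxf u x) + cutBt hd (ℓ + 1) a M ρ k s x * gBxf u x|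
        ≤ ((((ℓ + 1 : ℕ) : ℝ)) ^ j * η) ^ 2 * (|cutAt hd (ℓ + 1) a M ρ k s x * (η ^ 2 * gAxf u x)| + |cutBt hd (ℓ + 1) a M ρ k s x * gBxf u x|) :=
          mul_le_mul_of_nonneg_left (abs_add_le _ _) (by positivity)
      _ ≤ C' * N + (((ℓ + 1 : ℕ) : ℝ)) ^ 2 * CW * N := by rw [mul_add]; exact add_le_add hA hB
      _ = (C' + (((ℓ + 1 : ℕ) : ℝ)) ^ 2 * CW) * N := by ring
  -- (iv) `K₁` halves the `(−4)`-size: zero on `□₂` (§3), small at levels `≤ 1` (F4b `commutator_bound`)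
  have hKhalf : ∀ u N, 0 ≤ N → BW u N → BW (K₁ u) (N / 2) := by
    intro u N hN hu
    rw [hBW]
    intro j hj z hz
    have hzS : z ∈ S := hcubeS j hj z hz
    rcases Nat.lt_or_ge j 2 with hj1 | hj2
    · -- levels `≤ 1`
      have hcb := commutator_bound hMh1 a hn hnk hρd hρ0 hη0 w aw hw0 (by linarith [(haw 1 le_rfl).1]) (haw 1 le_rfl).2 hw K hK S hS hs1 hρs
        (gAxf u) (gBxf u) (A := C' * N * (η ^ 2)⁻¹) (B := CW * (N * (η ^ 2)⁻¹)) (by positivity) (by positivity)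
        (hAbound u N hN hu) (hBbound u N hN hu)
        (fun z hz => hgBx0 u z (fun h => hz (wall_subset hd (ℓ + 1) a M ρ k S (4 * s) h))) hzS hj hz
      rw [hK₁]
      have hwle : ((((ℓ + 1 : ℕ) : ℝ)) ^ j * η) ^ 2 ≤ (((ℓ + 1 : ℕ) : ℝ)) ^ 2 * η ^ 2 := by
        rw [mul_pow]
        refine mul_le_mul_of_nonneg_right ?_ hη2.le
        rw [← pow_mul]
        exact pow_le_pow_right₀ hLr (by omega)
      have hsplit : ∀ y : ℝ, ((((ℓ + 1 : ℕ) : ℝ)) ^ j * η) ^ 4 * |y| = ((((ℓ + 1 : ℕ) : ℝ)) ^ j * η) ^ 2 * (((((ℓ + 1 : ℕ) : ℝ)) ^ j * η) ^ 2 * |y|) := by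
        intro y; ring
      rw [hsplit]
      calc ((((ℓ + 1 : ℕ) : ℝ)) ^ j * η) ^ 2 * (((((ℓ + 1 : ℕ) : ℝ)) ^ j * η) ^ 2 *
            |∑ z' ∈ S, K z z' * ((cutAt hd (ℓ + 1) a M ρ k s z' - cutAt hd (ℓ + 1) a M ρ k s z) * (η ^ 2 * gAxf u z')
              + (cutBt hd (ℓ + 1) a M ρ k s z' - cutBt hd (ℓ + 1) a M ρ k s z) * gBxf u z')|)
          ≤ ((((ℓ + 1 : ℕ) : ℝ)) ^ 2 * η ^ 2) * (10 * ((d : ℝ) + 1) * (((ℓ + 1 : ℕ) : ℝ)) ^ 2 * (C' * N * (η ^ 2)⁻¹ + CW * (N * (η ^ 2)⁻¹)) / s) :=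
            mul_le_mul hwle hcb (by positivity) (by positivity)
        _ = 10 * ((d : ℝ) + 1) * (((ℓ + 1 : ℕ) : ℝ)) ^ 4 * (C' + CW) * N / s * (η ^ 2 * (η ^ 2)⁻¹) := by ring
        _ = 10 * ((d : ℝ) + 1) * (((ℓ + 1 : ℕ) : ℝ)) ^ 4 * (C' + CW) * N / s := by rw [mul_inv_cancel₀ hη2.ne', mul_one]
        _ ≤ N / 2 := by
            rw [div_le_iff₀ hs0r]
            have : 10 * ((d : ℝ) + 1) * (((ℓ + 1 : ℕ) : ℝ)) ^ 4 * (C' + CW) * N = (s₀ / 2) * N := by rw [hs₀]; ring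
            rw [this]
            have hN2 : 0 ≤ N / 2 := by positivity
            nlinarith
    · -- levels `≥ 2`: the row vanishes
      have hk2 : 2 ≤ k := hj2.trans (hj.trans hnk)
      have hz2 : z ∈ cube (ℓ + 1) a M ρ k 2 := by
        have hsub := B8Eq191FlatLettersCubeMember.cubeFam_antitone hL a M hρL k hj2
        rw [cubeFam_false_of_le _ a M ρ (hj.trans hnk), cubeFam_false_of_le _ a M ρ hk2] at hsub
        exact hsub hz
      rw [hK₁, commutator_vanish_deep a M hρL hnk hk2 w K hK S hs1 hs4 (gAxf u) (gBxf u) hz2, abs_zero, mul_zero]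
      positivity
  -- (v) the identity `ψ u x = P u x − ψ (K₁u) x` on `S`, from `T·P = 1 + K₁` and `T⁻¹T = 1`
  have hTunit : IsUnit T := by rw [hT]; exact isUnit_flatMatrix hd hη0 (ℓ + 1) n (cubeLamS (ℓ + 1) a M ρ k n) w hw0 K hK S
  have hTT : T⁻¹ * T = 1 := Matrix.nonsing_inv_mul T ((Matrix.isUnit_iff_isUnit_det T).mp hTunit)
  have hident : ∀ u (x : ↥S), ψ u x.1 = Pf u x.1 - ψ (K₁ u) x.1 := by
    intro u x
    have hrow : ∀ z : ↥S, ∑ y : ↥S, T z y * Pf u y.1 = u z.1 + K₁ u z.1 := by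
      intro z
      have hpi := parametrix_identity hℓ hMh1 a hn hnk hρd hMd hρ0 hR hη0 w aw hw0 hawpos hw K hK S hS hs1 (mW := 4 * s) le_rfl u
        (uAf u) (huAf u) (gAxf u) (hgAx_pull u) (uBf u) (huBf u) (gBxf u) (hgBx_mem u) (hgBx0 u) z.2
      rw [hK₁, ← hpi, ← Finset.sum_coe_sort S]
      refine Finset.sum_congr rfl fun y _ => ?_
      rw [hT, Matrix.of_apply, hPf]
    have h1 : ∑ z : ↥S, T⁻¹ x z * (u z.1 + K₁ u z.1) = Pf u x.1 := by
      calc ∑ z : ↥S, T⁻¹ x z * (u z.1 + K₁ u z.1)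
          = ∑ z : ↥S, T⁻¹ x z * ∑ y : ↥S, T z y * Pf u y.1 := Finset.sum_congr rfl fun z _ => by rw [hrow z]
        _ = ∑ y : ↥S, (∑ z : ↥S, T⁻¹ x z * T z y) * Pf u y.1 := by
            simp_rw [Finset.mul_sum]
            rw [Finset.sum_comm]
            refine Finset.sum_congr rfl fun y _ => ?_
            rw [Finset.sum_mul]
            refine Finset.sum_congr rfl fun z _ => ?_
            ring
        _ = ∑ y : ↥S, (T⁻¹ * T) x y * Pf u y.1 := Finset.sum_congr rfl fun y _ => by rw [Matrix.mul_apply]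
        _ = Pf u x.1 := by
            rw [hTT]
            simp_rw [Matrix.one_apply, ite_mul, one_mul, zero_mul]
            rw [Finset.sum_ite_eq]; simp
    have hψx : ψ u x.1 = ∑ z : ↥S, T⁻¹ x z * u z.1 := by rw [hψ, dif_pos x.2]
    have hψK : ψ (K₁ u) x.1 = ∑ z : ↥S, T⁻¹ x z * K₁ u z.1 := by rw [hψ, dif_pos x.2]
    rw [hψx, hψK, ← h1, ← Finset.sum_sub_distrib]
    refine Finset.sum_congr rfl fun z _ => ?_
    ring
  -- (vi) the crude bound (the level-0 reading `|u| ≤ Nη⁻⁴`)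
  have hcrude : ∀ (x : ↥S) u N, 0 ≤ N → BW u N → |ψ u x.1| ≤ ((η ^ 4)⁻¹ * ∑ z : ↥S, |T⁻¹ x z|) * N := by
    intro x u N hN hu
    rw [hBW] at hu
    rw [hψ, dif_pos x.2, Finset.mul_sum, Finset.sum_mul]
    refine (Finset.abs_sum_le_sum_abs _ _).trans (Finset.sum_le_sum fun z _ => ?_)
    rw [abs_mul]
    have hz0 : z.1 ∈ cube (ℓ + 1) a M ρ k 0 := by rw [← cubeFam_false_of_le (ℓ + 1) a M ρ (Nat.zero_le k)]; exact (hS z.1).mp z.2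
    have hb := hu 0 (Nat.zero_le n) z.1 hz0
    rw [pow_zero, one_mul] at hb
    have hη4 : 0 < η ^ 4 := by positivity
    have : |u z.1| ≤ (η ^ 4)⁻¹ * N := by rw [le_inv_mul_iff₀ hη4]; exact hb
    calc |T⁻¹ x z| * |u z.1| ≤ |T⁻¹ x z| * ((η ^ 4)⁻¹ * N) := mul_le_mul_of_nonneg_left this (abs_nonneg _)
      _ = (η ^ 4)⁻¹ * |T⁻¹ x z| * N := by ring
  -- (vii) the source `u₁` extended by zero, of size `r`
  obtain ⟨u₀, hu₀⟩ : ∃ u₀ : (Fin (d + 1) → ℤ) → ℝ, ∀ z, u₀ z = if h : z ∈ S then u₁ ⟨z, h⟩ else 0 := ⟨_, fun _ => rfl⟩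
  have hBWu₀ : BW u₀ r := by
    rw [hBW]
    intro j hj z hz
    have hzS : z ∈ S := hcubeS j hj z hz
    rw [hu₀, dif_pos hzS]
    have h := hu₁ j hj ⟨z, hzS⟩ (by rw [cubeFam_false_of_le _ a M ρ (hj.trans hnk)]; exact hz)
    simpa [wt] using h
  -- conclusion at `v ∈ □_{j₀}`: the a-priori bound for the weighted functional `u ↦ (L^{j₀}η)²ψ u v`
  have hvc : v.1 ∈ cube (ℓ + 1) a M ρ k j₀ := by rw [← cubeFam_false_of_le _ a M ρ (hj₀.trans hnk)]; exact hv
  have hmain := apriori_functional_bound BW K₁ (fun u => ((((ℓ + 1 : ℕ) : ℝ)) ^ j₀ * η) ^ 2 * ψ u v.1)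
    (fun u => ((((ℓ + 1 : ℕ) : ℝ)) ^ j₀ * η) ^ 2 * Pf u v.1) (C := C' + (((ℓ + 1 : ℕ) : ℝ)) ^ 2 * CW)
    (B₀ := ((((ℓ + 1 : ℕ) : ℝ)) ^ j₀ * η) ^ 2 * ((η ^ 4)⁻¹ * ∑ z : ↥S, |T⁻¹ v z|)) (by positivity)
    (fun u => by rw [hident u v]; ring)
    (fun u N hN hu => by rw [abs_mul, abs_of_nonneg (by positivity)]; exact hPbound u N hN hu j₀ hj₀ v.1 hvc)
    hKhalf
    (fun u N hN hu => by
      rw [abs_mul, abs_of_nonneg (by positivity), mul_assoc]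
      exact mul_le_mul_of_nonneg_left (hcrude v u N hN hu) (by positivity))
    u₀ hr hBWu₀
  have hφψ : ∑ z : ↥S, T⁻¹ v z * u₁ z = ψ u₀ v.1 := by
    rw [hψ, dif_pos v.2]
    refine Finset.sum_congr rfl fun z _ => ?_
    rw [hu₀, dif_pos z.2]
  rw [hφψ]
  have hwt : wt (ℓ + 1) η j₀ ^ 2 = ((((ℓ + 1 : ℕ) : ℝ)) ^ j₀ * η) ^ 2 := by simp [wt]
  rw [hwt, ← abs_of_nonneg (by positivity : (0 : ℝ) ≤ ((((ℓ + 1 : ℕ) : ℝ)) ^ j₀ * η) ^ 2), ← abs_mul]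
  simpa [mul_assoc] using hmain

/-! ## §5 The printed weights: REAL-1′ with no weight hypothesis left -/

open B8Eq1101CubeMemberWeights (awPrinted wPrinted awPrinted_facts wPrinted_facts)

open Classical in
/-- **(1.101) AT EXPONENT `−4 → −2` ON THE CUBE MEMBER WITH THE PRINTED WEIGHTS — THE HYPOTHESIS `hR1'` OF `B8Eq192CubeMemberOfReal1G.real2_of_real1_gbound` AT
`w = wPrinted`, NO WEIGHT HYPOTHESIS LEFT**: §4 at `a := awPrinted ℓ`, `c := 8`, `w := wPrinted d ℓ η` (as F4e does for exponent `−2 → 0`).  What remains displayed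
is print's: `η > 0`; the big-block size `M_h ≥ 3` with `M₀ ≤ L·M_h`; the cube datum on the big-block sub-lattice (`M_hL ∣ ρ`, `M_hL ∣ M`) with collar
`ρ = R₁M₁ ≥ R·M_hL`, `2L ≤ R`, `N₀ + 1 ≤ R·L·M_h`, `ρ ≥ ρ₀(d, L)`; the consumer's explicit matrix at these weights.
[cite: Balaban1985RegularSpaces, (1.101) p.93, p.98, (1.131) p.99; Balaban1985BackgroundPropagators, Theorem 3.1 (3.47) p.398; Balaban1984PropagatorsII, (2.14) p.225, Prop. 2.2 (2.67) p.234] -/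
theorem ineq1101_cubeMember_m4_printed (d ℓ : ℕ) (hℓ : 1 ≤ ℓ) :
    ∃ BG ρ₀ M₀ : ℝ, ∃ N₀ : ℕ, 0 < BG ∧ 0 < M₀ ∧ 0 < N₀ ∧
      ∀ (η : ℝ), 0 < η → ∀ (Mh : ℕ), 3 ≤ Mh → M₀ ≤ ((ℓ : ℝ) + 1) * Mh →
      ∀ (a : Fin (d + 1) → ℤ) (M ρ k n R : ℕ), 1 ≤ n → n ≤ k → Mh * (ℓ + 1) ∣ ρ → Mh * (ℓ + 1) ∣ M → 0 < ρ →
        R * (Mh * (ℓ + 1)) ≤ ρ → 2 * (ℓ + 1) ≤ R → N₀ + 1 ≤ R * ((ℓ + 1) * Mh) → ρ₀ ≤ (ρ : ℝ) →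
      ∀ (S : Finset (Fin (d + 1) → ℤ)), (∀ z, z ∈ S ↔ z ∈ cubeFam false (ℓ + 1) a M ρ k 0) →
      ∀ (K : (Fin (d + 1) → ℤ) → (Fin (d + 1) → ℤ) → ℝ), (∀ x z, K x z =
          ((η ^ 2)⁻¹ * ∑ μ : Fin (d + 1), ((2 : ℝ) * (if z = x then (1 : ℝ) else 0) - (if z = x + e μ then (1 : ℝ) else 0)
            - (if z = x - e μ then (1 : ℝ) else 0))) +
          (∑ j ∈ Finset.range (n + 1), (if blockMap ((ℓ + 1) ^ j) x ∈ cubeLamS (ℓ + 1) a M ρ k n j ∧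
              blockMap ((ℓ + 1) ^ j) z = blockMap ((ℓ + 1) ^ j) x then
            wPrinted d ℓ η j * (((((ℓ + 1 : ℕ) : ℝ) ^ (d + 1))⁻¹) ^ j) ^ 2 else 0))) →
      ∀ (T : Matrix ↥S ↥S ℝ), T = Matrix.of (fun x z : ↥S => K x.1 z.1) →
      ∀ (u : ↥S → ℝ) (r : ℝ), 0 ≤ r →
        (∀ j, j ≤ n → ∀ z : ↥S, z.1 ∈ cubeFam false (ℓ + 1) a M ρ k j → wt (ℓ + 1) η j ^ 4 * |u z| ≤ r) →
        ∀ j, j ≤ n → ∀ v : ↥S, v.1 ∈ cubeFam false (ℓ + 1) a M ρ k j →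
          wt (ℓ + 1) η j ^ 2 * |∑ z : ↥S, T⁻¹ v z * u z| ≤ BG * r := by
  obtain ⟨BG, ρ₀, M₀, N₀, hBG, hM₀, hN₀, h⟩ := ineq1101_cubeMember_m4 d ℓ hℓ
  refine ⟨BG, ρ₀, M₀, N₀, hBG, hM₀, hN₀, ?_⟩
  intro η hη Mh hMh hM0 a M ρ k n R hn hnk hρd hMd hρ0 hR hR2 hRN hρbig S hS K hK T hT u r hr hu
  obtain ⟨hwin, hpos, -, hrec⟩ := awPrinted_facts hℓ
  obtain ⟨hwpos, hrel, hwwin⟩ := wPrinted_facts d hℓ hη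
  exact h η hη Mh hMh hM0 a M ρ k n R hn hnk hρd hMd hρ0 hR hR2 hRN hρbig (awPrinted ℓ) (fun _ => 8) hwin
    (fun _ _ => by norm_num) (fun i hi => hrec i hi) hpos (wPrinted d ℓ η) hwpos (fun j _ _ => hrel j)
    (fun j hj => by
      rw [hwwin j]
      rcases Nat.eq_zero_or_pos j with h0 | hp
      · subst h0; norm_num [awPrinted]
      · exact hwin j hp)
    S hS K hK T hT u r hr hu

end Literature.MathematicalPhysics.QuantumFieldTheory.Balaban1983to89.B8Eq1101CubeMemberRealM4
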